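import Summits.ResolutionOfSingularities.ResolutionOfSingularities.Theorems.FrobeniusLadderFInjectiveMacaulayficationP3d4z4557Specimen
import Summits.ResolutionOfSingularities.ResolutionOfSingularities.Theorems.FrobeniusLadderFInjectiveMacaulayficationPointFloorNotFullOfFedder
import Summits.ResolutionOfSingularities.ResolutionOfSingularities.Theorems.FrobeniusLadderFInjectiveMacaulayficationLx6c3PointFloor
import HarnessLib

/-!
# (W-p3) THE POINT FLOOR OF P3d4z4557 = `z³ + x⁴ + y⁵ + u⁵ + t⁷` (char 3): LEGAL (admissible, CM) ∧ NOT FULL, for EVERY blowing up — the INPUT HALF of the first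
# characteristic-3 row of the F-half census
# (crux `FInjectiveMacaulayfication` stmt-ResolutionOfSingularities-15315, chain w45a; res-L1-w45a-plan-1 RULINGs R20.3 (Q3) / R21.1 (5) / R21.5 (3) / R21.6 (4) «(W-p3)»;
# = ONE application each of this seat's generic ✓p651649 `PointFloorLegalOfIsolated.pointFloor_input_legal` and ✓p652060 `PointFloorNotFullOfFedder.pointFloor_not_full`
# to the bed of `P3d4z4557Specimen`; seat res-L1-w45a-stub-3 g11; twin of `Lx6c3PointFloorCharts` + `Lx6c3PointFloor`)

[OURS · L1 W4.5a] Support file (`--supports stmt-ResolutionOfSingularities-15315 --as helper`); def-free; §1–§2 UNCONDITIONAL; §3 instantiates the CANDIDATE statements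
`IntrinsicTower.Recipes.TowerTerminates c` / `LocalFullificationFibreAdmGe4Split.LocalFInjectivizationFibreAdmGe4` taken as HYPOTHESES at `(d, p) = (4, 3)` (nothing
asserted about them). Replaces the role of NO printed item; NOT a statement of the manuscript; AI-written (AI review is weaker than expert review).

WHAT. `X = Spec A₀`, `A₀ = k[x,y,u,t,z]/(z³ + x⁴ + y⁵ + u⁵ + t⁷)` (`X 0 = x, X 1 = y, X 2 = u, X 3 = t, X 4 = z`), `char k = 3` (any field), `v` = the origin,
`𝔪 = (x̄,ȳ,ū,t̄,z̄) = 𝔪_v`, `I := 𝔪̃|_{Spec 𝒪_{X,v}}` — the POINT FLOOR. The five Rees charts of `Bl_𝔪 X` are the hypersurfaces `k[X]/(gᵢ)`, `θᵢ f = Xᵢ³·gᵢ`: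
`g_x = z³ + x + x²y⁵ + x²u⁵ + x⁴t⁷`, `g_y = z³ + x⁴y + y² + y²u⁵ + y⁴t⁷`, `g_u = z³ + x⁴u + y⁵u² + u² + u⁴t⁷`, `g_t = z³ + x⁴t + y⁵t² + u⁵t² + t⁴`,
`g_z = 1 + x⁴z + y⁵z² + u⁵z² + t⁷z⁴` (variables renamed back).
* §1 `theta`, `f_not_mem_span_X`, `g_not_mem_span_X`, `constantCoeff_g_one`, ★ `g_one_sq_mem_bracket` — the Fedder certificate of the `y`-chart:
  `g_y² = z³·(z³ + 2x⁴y + 2y²W) + x³·(x⁵y²) + y³·(yW² + 2x⁴W) ∈ (x³, y³, u³, t³, z³)`, `W = 1 + u⁵ + y²t⁷`;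
* §2 for EVERY blowing up `g : S′ → Spec 𝒪_{X,v}` along `I`: ★★ `pointFloor_p3d4z4557_input_legal` — `I ≠ ⊥` ∧ `Supp I ⊆ (Reg Spec 𝒪_{X,v})ᶜ` ∧ `S′` regular off the
  closed fibre ∧ `S′` CM at every stalk; ★★ `pointFloor_p3d4z4557_not_full` — some stalk of `S′` over the closed point is NOT `FullCl 3` (the origin of `D(ȳ)`);
  `not_recipeTowerFull_zero`;
* §3 BY NAME at `(d, p) = (4, 3)`: ★ `recipeTowerFull_of_towerTerminates`, ★ `fHalf_at_pointFloor` (every binder of the candidate statements discharged at this floor).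
The CURE half (an `𝔪·K` product certificate over `𝔽₃` Fedder cells, res-L1-w45a-idea-1 / res-L1-w45a-stub-2) is NOT in this file.
[folklore assembly; cite: GortzWedhorn2020, Prop. 13.91 (2), (13.19)] [cite: StacksProject, Tag 0804; Tag 02OS; Tag 01J7] [cite: Temkin2008, §2.1] [cite: Fedder1983, Prop. 1.7]
[cite: Kollar2007, §2.5 (strict transforms under point blow-ups)]
-/

-- single-problem summit: the doubled namespace component is forced
set_option linter.dupNamespace false

noncomputable section

namespace Summit.ResolutionOfSingularities.ResolutionOfSingularities.Theorems.FInjectiveMacaulayfication.P3d4z4557PointFloor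

open CategoryTheory CategoryTheory.Limits AlgebraicGeometry TopologicalSpace IsLocalRing MvPolynomial
open Literature.AlgebraicGeometry.Resolution
open Summit.ResolutionOfSingularities.ResolutionOfSingularities.Theorems.FInjectiveMacaulayfication
open SliceableCentre GermOfGlobalBlowup

variable (k : Type) [Field k]

/-! ## §1 The strict transforms and the Fedder certificate of the `y`-chart -/

/-- ★ **The chart identities** `θᵢ f = Xᵢ³ · gᵢ` for the point blow-up substitutions `θᵢ : Xⱼ ↦ XⱼXᵢ (j ≠ i), Xᵢ ↦ Xᵢ`. [folklore] -/
theorem theta (f : MvPolynomial (Fin 5) k) (hf : f = X 4 ^ 3 + X 0 ^ 4 + X 1 ^ 5 + X 2 ^ 5 + X 3 ^ 7) :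
    ∀ i : Fin 5, aeval (fun j : Fin 5 => if j = i then (X i : MvPolynomial (Fin 5) k) else X j * X i) f =
      X i ^ ((fun _ : Fin 5 => 3) i) * (![X 4 ^ 3 + X 0 + X 0 ^ 2 * X 1 ^ 5 + X 0 ^ 2 * X 2 ^ 5 + X 0 ^ 4 * X 3 ^ 7,
        X 4 ^ 3 + X 0 ^ 4 * X 1 + X 1 ^ 2 + X 1 ^ 2 * X 2 ^ 5 + X 1 ^ 4 * X 3 ^ 7,
        X 4 ^ 3 + X 0 ^ 4 * X 2 + X 1 ^ 5 * X 2 ^ 2 + X 2 ^ 2 + X 2 ^ 4 * X 3 ^ 7,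
        X 4 ^ 3 + X 0 ^ 4 * X 3 + X 1 ^ 5 * X 3 ^ 2 + X 2 ^ 5 * X 3 ^ 2 + X 3 ^ 4,
        1 + X 0 ^ 4 * X 4 + X 1 ^ 5 * X 4 ^ 2 + X 2 ^ 5 * X 4 ^ 2 + X 3 ^ 7 * X 4 ^ 4] : Fin 5 → MvPolynomial (Fin 5) k) i := by
  intro i
  subst hf
  fin_cases i <;> simp <;> ring

/-- `f ∉ (Xᵢ)` for every `i`: evaluate at a coordinate point with `Xᵢ = 0` where `f = 1`. [folklore] -/
theorem f_not_mem_span_X (f : MvPolynomial (Fin 5) k) (hf : f = X 4 ^ 3 + X 0 ^ 4 + X 1 ^ 5 + X 2 ^ 5 + X 3 ^ 7) :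
    ∀ i : Fin 5, f ∉ Ideal.span {(X i : MvPolynomial (Fin 5) k)} := by
  intro i h
  rw [Ideal.mem_span_singleton] at h
  obtain ⟨c, hc⟩ := h
  by_cases hi : i = 4
  · subst hi
    have := congrArg (MvPolynomial.eval (Pi.single 0 1 : Fin 5 → k)) hc
    rw [hf] at this
    simp at this
  · have := congrArg (MvPolynomial.eval (Pi.single 4 1 : Fin 5 → k)) hc
    rw [hf] at this
    have h1 : (Pi.single 4 1 : Fin 5 → k) i = 0 := by rw [Pi.single_apply, if_neg hi]
    simp [h1] at this

/-- `gᵢ ∉ (Xᵢ)` for every `i`: evaluate at `e_z` (`gᵢ = 1` there, `i ≤ 3`) resp. at `0` (`g_z(0) = 1`). [folklore] -/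
theorem g_not_mem_span_X :
    ∀ i : Fin 5, (![X 4 ^ 3 + X 0 + X 0 ^ 2 * X 1 ^ 5 + X 0 ^ 2 * X 2 ^ 5 + X 0 ^ 4 * X 3 ^ 7,
        X 4 ^ 3 + X 0 ^ 4 * X 1 + X 1 ^ 2 + X 1 ^ 2 * X 2 ^ 5 + X 1 ^ 4 * X 3 ^ 7,
        X 4 ^ 3 + X 0 ^ 4 * X 2 + X 1 ^ 5 * X 2 ^ 2 + X 2 ^ 2 + X 2 ^ 4 * X 3 ^ 7,
        X 4 ^ 3 + X 0 ^ 4 * X 3 + X 1 ^ 5 * X 3 ^ 2 + X 2 ^ 5 * X 3 ^ 2 + X 3 ^ 4,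
        1 + X 0 ^ 4 * X 4 + X 1 ^ 5 * X 4 ^ 2 + X 2 ^ 5 * X 4 ^ 2 + X 3 ^ 7 * X 4 ^ 4] : Fin 5 → MvPolynomial (Fin 5) k) i ∉ Ideal.span {(X i : MvPolynomial (Fin 5) k)} := by
  intro i h
  rw [Ideal.mem_span_singleton] at h
  obtain ⟨c, hc⟩ := h
  fin_cases i
  · have := congrArg (MvPolynomial.eval (Pi.single 4 1 : Fin 5 → k)) hc; simp at this
  · have := congrArg (MvPolynomial.eval (Pi.single 4 1 : Fin 5 → k)) hc; simp at this
  · have := congrArg (MvPolynomial.eval (Pi.single 4 1 : Fin 5 → k)) hc; simp at this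
  · have := congrArg (MvPolynomial.eval (Pi.single 4 1 : Fin 5 → k)) hc; simp at this
  · have := congrArg (MvPolynomial.eval (0 : Fin 5 → k)) hc; simp at this

/-- `g_y` has no constant term. [plumbing] -/
theorem constantCoeff_g_one : constantCoeff ((![X 4 ^ 3 + X 0 + X 0 ^ 2 * X 1 ^ 5 + X 0 ^ 2 * X 2 ^ 5 + X 0 ^ 4 * X 3 ^ 7,
        X 4 ^ 3 + X 0 ^ 4 * X 1 + X 1 ^ 2 + X 1 ^ 2 * X 2 ^ 5 + X 1 ^ 4 * X 3 ^ 7,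
        X 4 ^ 3 + X 0 ^ 4 * X 2 + X 1 ^ 5 * X 2 ^ 2 + X 2 ^ 2 + X 2 ^ 4 * X 3 ^ 7,
        X 4 ^ 3 + X 0 ^ 4 * X 3 + X 1 ^ 5 * X 3 ^ 2 + X 2 ^ 5 * X 3 ^ 2 + X 3 ^ 4,
        1 + X 0 ^ 4 * X 4 + X 1 ^ 5 * X 4 ^ 2 + X 2 ^ 5 * X 4 ^ 2 + X 3 ^ 7 * X 4 ^ 4] : Fin 5 → MvPolynomial (Fin 5) k) 1) = 0 := by
  simp [constantCoeff_X]

/-- ★ **The Fedder certificate of the `y`-chart**: `g_y² ∈ 𝔫^{[3]} = (X0³, …, X4³)`, via the explicit decomposition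
`g_y² = z³·(z³ + 2x⁴y + 2y²W) + x³·(x⁵y²) + y³·(yW² + 2x⁴W)`, `W = 1 + u⁵ + y²t⁷`. [certificate; cite: Fedder1983, Prop. 1.7] -/
theorem g_one_sq_mem_bracket :
    ((![X 4 ^ 3 + X 0 + X 0 ^ 2 * X 1 ^ 5 + X 0 ^ 2 * X 2 ^ 5 + X 0 ^ 4 * X 3 ^ 7,
        X 4 ^ 3 + X 0 ^ 4 * X 1 + X 1 ^ 2 + X 1 ^ 2 * X 2 ^ 5 + X 1 ^ 4 * X 3 ^ 7,
        X 4 ^ 3 + X 0 ^ 4 * X 2 + X 1 ^ 5 * X 2 ^ 2 + X 2 ^ 2 + X 2 ^ 4 * X 3 ^ 7,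
        X 4 ^ 3 + X 0 ^ 4 * X 3 + X 1 ^ 5 * X 3 ^ 2 + X 2 ^ 5 * X 3 ^ 2 + X 3 ^ 4,
        1 + X 0 ^ 4 * X 4 + X 1 ^ 5 * X 4 ^ 2 + X 2 ^ 5 * X 4 ^ 2 + X 3 ^ 7 * X 4 ^ 4] : Fin 5 → MvPolynomial (Fin 5) k) 1) ^ (3 - 1) ∈
      Ideal.span (Set.range fun i : Fin 5 => (X i : MvPolynomial (Fin 5) k) ^ 3) := by
  have hcu : ∀ j : Fin 5, (X j : MvPolynomial (Fin 5) k) ^ 3 ∈ Ideal.span (Set.range fun i : Fin 5 => (X i : MvPolynomial (Fin 5) k) ^ 3) :=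
    fun j => Ideal.subset_span ⟨j, rfl⟩
  change (X 4 ^ 3 + X 0 ^ 4 * X 1 + X 1 ^ 2 + X 1 ^ 2 * X 2 ^ 5 + X 1 ^ 4 * X 3 ^ 7 : MvPolynomial (Fin 5) k) ^ (3 - 1) ∈ _
  have e : (X 4 ^ 3 + X 0 ^ 4 * X 1 + X 1 ^ 2 + X 1 ^ 2 * X 2 ^ 5 + X 1 ^ 4 * X 3 ^ 7 : MvPolynomial (Fin 5) k) ^ (3 - 1) =
      X 4 ^ 3 * (X 4 ^ 3 + 2 * X 0 ^ 4 * X 1 + 2 * X 1 ^ 2 * (1 + X 2 ^ 5 + X 1 ^ 2 * X 3 ^ 7)) +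
      X 0 ^ 3 * (X 0 ^ 5 * X 1 ^ 2) +
      X 1 ^ 3 * (X 1 * (1 + X 2 ^ 5 + X 1 ^ 2 * X 3 ^ 7) ^ 2 + 2 * X 0 ^ 4 * (1 + X 2 ^ 5 + X 1 ^ 2 * X 3 ^ 7)) := by
    rw [show (3 - 1 : ℕ) = 2 from rfl]
    ring
  rw [e]
  exact Ideal.add_mem _ (Ideal.add_mem _ (Ideal.mul_mem_right _ _ (hcu 4)) (Ideal.mul_mem_right _ _ (hcu 0))) (Ideal.mul_mem_right _ _ (hcu 1))

/-! ## §2 For EVERY blowing up along the point floor: legal ∧ not FULL -/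

/-- ★★ **THE POINT FLOOR OF P3d4z4557 IS A LEGAL INPUT** of `TowerTerminates` / the F-half: for every blowing up `g : S′ → Spec 𝒪_{X,v}` along `I = 𝔪̃|_{Spec 𝒪_{X,v}}`:
(1) `I ≠ ⊥`; (2) `Supp I ⊆ (Reg Spec 𝒪_{X,v})ᶜ`; (3) `S′` is regular off the closed fibre; (4) `S′` satisfies the CM clause at every point — ONE application of the generic
`PointFloorLegalOfIsolated.pointFloor_input_legal`. [folklore assembly; cite: GortzWedhorn2020, Prop. 13.91 (2)] [cite: StacksProject, Tag 02OS; Tag 01J7] [cite: Temkin2008, §2.1] -/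
theorem pointFloor_p3d4z4557_input_legal [CharP k 3] (f : MvPolynomial (Fin 5) k) (hf : f = X 4 ^ 3 + X 0 ^ 4 + X 1 ^ 5 + X 2 ^ 5 + X 3 ^ 7)
    (v : Spec (.of (MvPolynomial (Fin 5) k ⧸ Ideal.span {f})))
    (hv : v.asIdeal = Ideal.span (Set.range (fun j : Fin 5 => Ideal.Quotient.mk (Ideal.span {f}) (X j))))
    (S' : Scheme.{0}) (g : S' ⟶ Spec ((Spec (.of (MvPolynomial (Fin 5) k ⧸ Ideal.span {f}))).presheaf.stalk v))
    (hg : IsBlowup g ((affineBlowup.idealSheaf (Ideal.span (Set.range (fun j : Fin 5 => Ideal.Quotient.mk (Ideal.span {f}) (X j))))).comap ((Spec (.of (MvPolynomial (Fin 5) k ⧸ Ideal.span {f}))).fromSpecStalk v))) :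
    ((affineBlowup.idealSheaf (Ideal.span (Set.range (fun j : Fin 5 => Ideal.Quotient.mk (Ideal.span {f}) (X j))))).comap ((Spec (.of (MvPolynomial (Fin 5) k ⧸ Ideal.span {f}))).fromSpecStalk v)) ≠ ⊥ ∧
    (((((affineBlowup.idealSheaf (Ideal.span (Set.range (fun j : Fin 5 => Ideal.Quotient.mk (Ideal.span {f}) (X j))))).comap ((Spec (.of (MvPolynomial (Fin 5) k ⧸ Ideal.span {f}))).fromSpecStalk v))).support : Set (Spec ((Spec (.of (MvPolynomial (Fin 5) k ⧸ Ideal.span {f}))).presheaf.stalk v))) ⊆ (Scheme.regularLocus (Spec ((Spec (.of (MvPolynomial (Fin 5) k ⧸ Ideal.span {f}))).presheaf.stalk v)))ᶜ) ∧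
    (∀ s : S', g.base s ≠ closedPoint ((Spec (.of (MvPolynomial (Fin 5) k ⧸ Ideal.span {f}))).presheaf.stalk v) → s ∈ Scheme.regularLocus S') ∧
    (∀ s : S', CMCl (S'.presheaf.stalk s)) :=
  PointFloorLegalOfIsolated.pointFloor_input_legal k f (P3d4z4557Specimen.prime_f k f hf) (by norm_num) (fun _ : Fin 5 => 3) _ (theta k f hf)
    (f_not_mem_span_X k f hf) (g_not_mem_span_X k) v hv (P3d4z4557Specimen.vertex_not_mem_regularLocus k f hf v hv)
    (P3d4z4557Specimen.regular_of_ne_vertex k f hf v hv) S' g hg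

/-- ★★ **THE POINT FLOOR OF P3d4z4557 IS NOT FULL**: for every blowing up `g : S′ → Spec 𝒪_{X,v}` along `I` there is a point `s ∈ S′` over the closed point whose local
ring is NOT `FullCl 3` (the origin of the chart `D(ȳ)`, Fedder certificate `g_one_sq_mem_bracket`) — ONE application of the generic `PointFloorNotFullOfFedder.pointFloor_not_full`.
[OURS · assembly; cite: Fedder1983, Prop. 1.7; GortzWedhorn2020, Prop. 13.91 (2)] -/
theorem pointFloor_p3d4z4557_not_full [CharP k 3] (f : MvPolynomial (Fin 5) k) (hf : f = X 4 ^ 3 + X 0 ^ 4 + X 1 ^ 5 + X 2 ^ 5 + X 3 ^ 7)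
    (v : Spec (.of (MvPolynomial (Fin 5) k ⧸ Ideal.span {f})))
    (hv : v.asIdeal = Ideal.span (Set.range (fun j : Fin 5 => Ideal.Quotient.mk (Ideal.span {f}) (X j))))
    (S' : Scheme.{0}) (g : S' ⟶ Spec ((Spec (.of (MvPolynomial (Fin 5) k ⧸ Ideal.span {f}))).presheaf.stalk v))
    (hg : IsBlowup g ((affineBlowup.idealSheaf (Ideal.span (Set.range (fun j : Fin 5 => Ideal.Quotient.mk (Ideal.span {f}) (X j))))).comap ((Spec (.of (MvPolynomial (Fin 5) k ⧸ Ideal.span {f}))).fromSpecStalk v))) :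
    ∃ s : S', g.base s = closedPoint ((Spec (.of (MvPolynomial (Fin 5) k ⧸ Ideal.span {f}))).presheaf.stalk v) ∧ ¬ FullCl 3 (S'.presheaf.stalk s) := by
  haveI : Fact (Nat.Prime 3) := ⟨Nat.prime_three⟩
  exact PointFloorNotFullOfFedder.pointFloor_not_full 3 k f (P3d4z4557Specimen.prime_f k f hf) (fun _ : Fin 5 => 3) _ (theta k f hf)
    (f_not_mem_span_X k f hf) (g_not_mem_span_X k) (P3d4z4557Specimen.constantCoeff_f k f hf) 1 (constantCoeff_g_one k)
    (g_one_sq_mem_bracket k) v hv S' g hg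

/-- Hence no recipe tower of height `0` from this floor: `¬ RecipeTowerFull c 3 0 S′`, for EVERY centre recipe `c`. [OURS] -/
theorem not_recipeTowerFull_zero [CharP k 3] (c : IntrinsicTower.Recipes.CentreRecipe) (f : MvPolynomial (Fin 5) k) (hf : f = X 4 ^ 3 + X 0 ^ 4 + X 1 ^ 5 + X 2 ^ 5 + X 3 ^ 7)
    (v : Spec (.of (MvPolynomial (Fin 5) k ⧸ Ideal.span {f})))
    (hv : v.asIdeal = Ideal.span (Set.range (fun j : Fin 5 => Ideal.Quotient.mk (Ideal.span {f}) (X j))))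
    (S' : Scheme.{0}) (g : S' ⟶ Spec ((Spec (.of (MvPolynomial (Fin 5) k ⧸ Ideal.span {f}))).presheaf.stalk v))
    (hg : IsBlowup g ((affineBlowup.idealSheaf (Ideal.span (Set.range (fun j : Fin 5 => Ideal.Quotient.mk (Ideal.span {f}) (X j))))).comap ((Spec (.of (MvPolynomial (Fin 5) k ⧸ Ideal.span {f}))).fromSpecStalk v))) :
    ¬ IntrinsicTower.Recipes.RecipeTowerFull c 3 0 S' := by
  intro h0
  obtain ⟨s, -, hs⟩ := pointFloor_p3d4z4557_not_full k f hf v hv S' g hg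
  exact hs (IntrinsicTower.Recipes.recipeTowerFull_zero.mp h0 s)

/-! ## §3 The binders of `TowerTerminates` and of the F-half are met at this floor, BY NAME, at `(d, p) = (4, 3)` -/

/-- ★ **`TowerTerminates c`, instantiated at the point floor of P3d4z4557** (the candidate taken as a hypothesis; all its binders discharged at `(d,p) = (4,3)`): the
`c`-tower from `S′` terminates at some height `n` (`≥ 1` by §2). [OURS · instantiation of a candidate statement] -/
theorem recipeTowerFull_of_towerTerminates [CharP k 3] (c : IntrinsicTower.Recipes.CentreRecipe) (hTT : IntrinsicTower.Recipes.TowerTerminates c)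
    (f : MvPolynomial (Fin 5) k) (hf : f = X 4 ^ 3 + X 0 ^ 4 + X 1 ^ 5 + X 2 ^ 5 + X 3 ^ 7)
    (v : Spec (.of (MvPolynomial (Fin 5) k ⧸ Ideal.span {f})))
    (hv : v.asIdeal = Ideal.span (Set.range (fun j : Fin 5 => Ideal.Quotient.mk (Ideal.span {f}) (X j))))
    (S' : Scheme.{0}) (g : S' ⟶ Spec ((Spec (.of (MvPolynomial (Fin 5) k ⧸ Ideal.span {f}))).presheaf.stalk v))
    (hg : IsBlowup g ((affineBlowup.idealSheaf (Ideal.span (Set.range (fun j : Fin 5 => Ideal.Quotient.mk (Ideal.span {f}) (X j))))).comap ((Spec (.of (MvPolynomial (Fin 5) k ⧸ Ideal.span {f}))).fromSpecStalk v))) :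
    ∃ n : ℕ, IntrinsicTower.Recipes.RecipeTowerFull c 3 n S' := by
  haveI := P3d4z4557Specimen.isIntegral_p3d4z4557 k f hf
  obtain ⟨h1, h2, h3, h4⟩ := pointFloor_p3d4z4557_input_legal k f hf v hv S' g hg
  exact hTT 4 le_rfl 3 Nat.prime_three k (Spec (.of (MvPolynomial (Fin 5) k ⧸ Ideal.span {f})))
    (Spec.map (CommRingCat.ofHom (algebraMap k (MvPolynomial (Fin 5) k ⧸ Ideal.span {f}))))
    (FermatCubicConeGerm.structureMorphism_isSeparated k f) (FermatCubicConeGerm.structureMorphism_locallyOfFiniteType k f)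
    (FermatCubicConeGerm.structureMorphism_quasiCompact k f) inferInstance v (P3d4z4557Specimen.isClosed_vertex k f hf v hv)
    (P3d4z4557Specimen.vertex_not_mem_regularLocus k f hf v hv) (P3d4z4557Specimen.ringKrullDim_stalk_vertex k f hf v hv) S' g _ h1 h2 hg h3 h4

/-- ★ **The candidate F-half `LocalFInjectivizationFibreAdmGe4` (taken as a hypothesis), instantiated at the point floor of P3d4z4557, `(d, p) = (4, 3)`.**
Discharging its conclusion here UNCONDITIONALLY (an `𝔪·K` certificate) would make this the first two-sided characteristic-3 row. [OURS · instantiation of a candidate statement] -/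
theorem fHalf_at_pointFloor [CharP k 3] (h : LocalFullificationFibreAdmGe4Split.LocalFInjectivizationFibreAdmGe4) (f : MvPolynomial (Fin 5) k)
    (hf : f = X 4 ^ 3 + X 0 ^ 4 + X 1 ^ 5 + X 2 ^ 5 + X 3 ^ 7)
    (v : Spec (.of (MvPolynomial (Fin 5) k ⧸ Ideal.span {f})))
    (hv : v.asIdeal = Ideal.span (Set.range (fun j : Fin 5 => Ideal.Quotient.mk (Ideal.span {f}) (X j))))
    (S' : Scheme.{0}) (g : S' ⟶ Spec ((Spec (.of (MvPolynomial (Fin 5) k ⧸ Ideal.span {f}))).presheaf.stalk v))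
    (hg : IsBlowup g ((affineBlowup.idealSheaf (Ideal.span (Set.range (fun j : Fin 5 => Ideal.Quotient.mk (Ideal.span {f}) (X j))))).comap ((Spec (.of (MvPolynomial (Fin 5) k ⧸ Ideal.span {f}))).fromSpecStalk v))) :
    ∃ 𝓚 : S'.IdealSheafData, 𝓚 ≠ ⊥ ∧
      (∀ s ∈ (𝓚.support : Set S'), g.base s = closedPoint ((Spec (.of (MvPolynomial (Fin 5) k ⧸ Ideal.span {f}))).presheaf.stalk v)) ∧
      ∀ (S'' : Scheme.{0}) (π : S'' ⟶ S'), IsBlowup π 𝓚 → ∀ s : S'', FullCl 3 (S''.presheaf.stalk s) := by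
  haveI := P3d4z4557Specimen.isIntegral_p3d4z4557 k f hf
  obtain ⟨h1, h2, h3, h4⟩ := pointFloor_p3d4z4557_input_legal k f hf v hv S' g hg
  exact h 4 le_rfl 3 Nat.prime_three k (Spec (.of (MvPolynomial (Fin 5) k ⧸ Ideal.span {f})))
    (Spec.map (CommRingCat.ofHom (algebraMap k (MvPolynomial (Fin 5) k ⧸ Ideal.span {f}))))
    (FermatCubicConeGerm.structureMorphism_isSeparated k f) (FermatCubicConeGerm.structureMorphism_locallyOfFiniteType k f)
    (FermatCubicConeGerm.structureMorphism_quasiCompact k f) inferInstance v (P3d4z4557Specimen.isClosed_vertex k f hf v hv)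
    (P3d4z4557Specimen.vertex_not_mem_regularLocus k f hf v hv) (P3d4z4557Specimen.ringKrullDim_stalk_vertex k f hf v hv) S' g _ h1 h2 hg h3 h4

end Summit.ResolutionOfSingularities.ResolutionOfSingularities.Theorems.FInjectiveMacaulayfication.P3d4z4557PointFloor

end
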